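import Summits.Ventures.PercRepro.Night2LineIncome
import Summits.Ventures.PercRepro.Night2LineSharp
import Summits.Ventures.PercRepro.Night2NonFatLineCell
import Summits.Ventures.PercRepro.Night2NonFatTen

/-!
# night-2: THE NON-FAT CASE OF (FAIR) FOR LARGE `G` — h21's cell `(2, 1)` holds for `|G| ≥ 44` (gen 38)

A lossy non-fat basis pair has two basis points `a, b` whose line carries all but `k ≤ 25` points of `W`
(`exists_pair_card_sdiff_clF_le_25`); `k ≥ 2` since `rk W ≥ 4`.  For `k = 2` the pair is fair by the line + 2 theorem of gen 37
(`basis_pair_fair_of_line_plus_two`); for `k = 3` by the single-family line theorem (`lineIncome 9 3 ≥ 1`, monotone in `d`);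
for `4 ≤ k ≤ 25` by the multi-family line theorem with `d = N − k ≥ N − 25 ≥ 13`:
`lineIncome 13 k + k · lineIncome 13 (k − 1) ≥ 5 · lineIncome 13 25 ≥ 1` (`one_le_lineIncome_plus_thirteen`).  So
**`basis_pair_fair_of_large`**: every lossy non-fat pair with `N ≥ 38` is fair.  Hence **`localShadowHall_nonfat_of_large`**
(no fat closure, `|G| ≥ 44`) and, with the fat cases of gens 28 / 36, **`localShadowHall_two_one_of_large`**: h21's cell
`(2, 1)` for every `|G| ≥ 44`.
Paper: proofs/NIGHT-2-g38.md §4.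
-/

namespace PercRepro.Shadow

open PercRepro.ThmH PercRepro.PerFlat

variable {α : Type*} [DecidableEq α] {M : Matroid α} [M.Finite] {G : Finset α}

/-- `5 · lineIncome 13 25 ≥ 1`. -/
theorem one_le_five_mul_lineIncome_thirteen_twentyfive : 1 ≤ 5 * lineIncome 13 25 := by
  unfold lineIncome lineFaceBound
  simp only [Finset.sum_range_succ, Finset.sum_range_zero]
  norm_num [Nat.choose]

/-- The multi-family income at `d = 13` is at least `1` for every `4 ≤ k ≤ 25`:
`lineIncome 13 k + k · lineIncome 13 (k − 1) ≥ (1 + k) · lineIncome 13 25 ≥ 5 · lineIncome 13 25 ≥ 1`. -/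
theorem one_le_lineIncome_plus_thirteen {k : ℕ} (hk4 : 4 ≤ k) (hk25 : k ≤ 25) :
    1 ≤ lineIncome 13 k + (k : ℚ) * lineIncome 13 (k - 1) := by
  have h1 := lineIncome_anti_right 13 hk25
  have h2 := lineIncome_anti_right 13 (show k - 1 ≤ 25 by omega)
  have h3 := one_le_five_mul_lineIncome_thirteen_twentyfive
  have hk : (4 : ℚ) ≤ (k : ℚ) := by exact_mod_cast hk4
  have h0 : 0 ≤ lineIncome 13 25 := by linarith
  nlinarith

/-- At least two points of `W` lie off any basis line: `rk W ≥ 4` while `W ∩ cl {a, b}` has rank `≤ 2`. -/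
theorem two_le_card_sdiff_clF_pair (hd : (gr M \ G).card = 2) {B : Finset α} (hB : B ∈ thinMembers M 5 G)
    (z : α) (a b : α) : 2 ≤ ((G \ insert z B) \ clF M {a, b}).card := by
  have h4 := four_le_rkN_sdiff_insert hd hB z
  have hsplit : G \ insert z B = ((G \ insert z B) ∩ clF M {a, b}) ∪ ((G \ insert z B) \ clF M {a, b}) := by
    rw [Finset.union_comm, Finset.sdiff_union_inter]
  have h1 := rkN_union_le_rkN_add_card (M := M) ((G \ insert z B) ∩ clF M {a, b}) ((G \ insert z B) \ clF M {a, b})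
  have h2 : rkN M ((G \ insert z B) ∩ clF M {a, b}) ≤ 2 :=
    le_trans (rkN_le_of_subset_clF' Finset.inter_subset_right) (le_trans (rkN_le_card _) Finset.card_le_two)
  rw [← hsplit] at h1
  omega

/-- **Every lossy non-fat basis pair with `N = |W| ≥ 38` is fair.** -/
theorem basis_pair_fair_of_large (hG : G ∈ flatsQ M (5 + 1)) (hd : (gr M \ G).card = 2)
    (hk : kColoops M G = 1) (hs : ∀ e ∈ gr M, ∀ f ∈ gr M, e ≠ f → rkN M {e, f} = 2)
    (hl : ∀ e ∈ gr M, M.Indep {e}) (hnf : fatClosures M 5 G 2 = ∅) {B : Finset α}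
    (hB : B ∈ thinMembers M 5 G) (hnP : ¬ bigP M G B) {z : α} (hz : z ∈ G \ clF M B)
    (hl0 : loss M 5 G B z ≠ 0) (hN : 38 ≤ (G \ insert z B).card) :
    loss M 5 G B z ≤ rhoL M 5 G B z * lossIncomeH M 5 G (bigP M G) (dshGT2 M 5 G) B z := by
  obtain ⟨a, ha, b, hb, hab, hk25⟩ := exists_pair_card_sdiff_clF_le_25 hG hd hk hnf hB hnP hz hl0
  have h2 := two_le_card_sdiff_clF_pair hd hB z a b
  have hsplit := Finset.card_sdiff_add_card_inter (G \ insert z B) (clF M {a, b})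
  rcases Nat.lt_or_ge ((G \ insert z B) \ clF M {a, b}).card 3 with hlt | hge
  · -- exactly two points off the line: the line + 2 theorem of gen 37
    have hk2 : ((G \ insert z B) \ clF M {a, b}).card = 2 := by omega
    obtain ⟨y₁, y₂, hne, hy⟩ := Finset.card_eq_two.1 hk2
    have hy₁ : y₁ ∈ (G \ insert z B) \ clF M {a, b} := by
      rw [hy]
      exact Finset.mem_insert_self _ _
    have hy₂ : y₂ ∈ (G \ insert z B) \ clF M {a, b} := by
      rw [hy]
      exact Finset.mem_insert_of_mem (Finset.mem_singleton_self _)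
    obtain ⟨-, hQ'5⟩ := rkN_insert_sdiff_coloops_eq_five hG hd hk hB hnP hz
    have habQ' : ({a, b} : Finset α) ⊆ insert z B \ coloops M G := by
      intro x hx
      rw [Finset.mem_insert, Finset.mem_singleton] at hx
      rcases hx with rfl | rfl
      · exact ha
      · exact hb
    have hA3 : ((insert z B \ coloops M G) \ {a, b}).card = 3 := by
      rw [Finset.card_sdiff_of_subset habQ', hQ'5, Finset.card_pair hab]
    apply basis_pair_fair_of_line_plus_two hG hd hk hs hl hnf hB hnP hz hl0 Finset.sdiff_subset hA3 hne
      (Finset.mem_sdiff.1 hy₁).1 (Finset.mem_sdiff.1 hy₂).1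
    intro y hyW hy1 hy2
    have hyl : y ∈ clF M {a, b} := by
      by_contra hnot
      have : y ∈ (G \ insert z B) \ clF M {a, b} := Finset.mem_sdiff.2 ⟨hyW, hnot⟩
      rw [hy, Finset.mem_insert, Finset.mem_singleton] at this
      rcases this with h | h
      · exact hy1 h
      · exact hy2 h
    have hGg : G ⊆ gr M := (mem_flatsQ.1 hG).1
    have hQG : insert z B ⊆ G := Finset.insert_subset (Finset.mem_sdiff.1 hz).1 (subset_G_of_mem_thinMembers hB)
    have hmem : ({a, b} : Finset α) ⊆ insert z B \ ((insert z B \ coloops M G) \ {a, b}) := by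
      intro x hx
      have hxab : x ∈ ({a, b} : Finset α) := hx
      rw [Finset.mem_insert, Finset.mem_singleton] at hx
      rw [Finset.mem_sdiff, Finset.mem_sdiff]
      refine ⟨?_, fun h => h.2 hxab⟩
      rcases hx with rfl | rfl
      · exact (Finset.mem_sdiff.1 ha).1
      · exact (Finset.mem_sdiff.1 hb).1
    have hcl : clF M {a, b} ⊆ clF M (insert z B \ ((insert z B \ coloops M G) \ {a, b})) :=
      clF_subset_clF_of_subset_clF (hmem.trans (subset_clF_of_subset_gr (Finset.sdiff_subset.trans (hQG.trans hGg))))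
    exact hcl hyl
  · rcases Nat.lt_or_ge ((G \ insert z B) \ clF M {a, b}).card 4 with hlt4 | hge4
    · -- exactly three points off the line: the single-family line theorem with `d ≥ 13`
      apply basis_pair_fair_of_line_of_le hG hd hk hs hl hnf hB hnP hz hl0 ha hb hab (Finset.Subset.refl _) hge ?_
        (d₀ := 13) (k₀ := 3) (by omega) (by omega) ?_
      · rw [Finset.sdiff_self]
        have := rkN_le_card (M := M) (∅ : Finset α)
        rw [Finset.card_empty] at this
        omega
      · exact le_trans one_le_lineIncome_nine_three (lineIncome_mono_left (by norm_num) 3)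
    · -- at least four points off the line: the multi-family line theorem with `d ≥ 13`, `4 ≤ k ≤ 25`
      exact basis_pair_fair_of_line_plus hG hd hk hs hl hnf hB hnP hz hl0 ha hb hab hge4 rfl (by omega)
        (one_le_lineIncome_plus_thirteen hge4 hk25)

/-- **The cell `(2, 1)` with no fat closure satisfies the local Hall inequality for `|G| ≥ 44`.** -/
theorem localShadowHall_nonfat_of_large (hG : G ∈ flatsQ M (5 + 1)) (hd : (gr M \ G).card = 2)
    (hk : kColoops M G = 1) (hs : ∀ e ∈ gr M, ∀ f ∈ gr M, e ≠ f → rkN M {e, f} = 2)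
    (hl : ∀ e ∈ gr M, M.Indep {e}) (hnf : fatClosures M 5 G 2 = ∅) (h44 : 44 ≤ G.card) :
    LocalShadowHall M 5 G := by
  have hfat : (fatClosures M 5 G 2).card ≤ 1 := by
    rw [hnf, Finset.card_empty]
    exact zero_le_one
  apply localShadowHall_of_gt2_of_basis_fair hG hd hk hs hl hfat
  intro B hB hnP z hz
  by_cases hl0 : loss M 5 G B z = 0
  · rw [hl0]
    have hd' : (gr M \ G).card ≤ 5 := by omega
    have h1 : 0 ≤ rhoL M 5 G B z := by
      unfold rhoL
      rw [hl0]
      simp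
    have h2 : 0 ≤ lossIncomeH M 5 G (bigP M G) (dshGT2 M 5 G) B z :=
      lossIncomeH_nonneg hG hd' (column_side_gt2 hG hd hk hs hl hfat) B z
    positivity
  · apply basis_pair_fair_of_large hG hd hk hs hl hnf hB hnP hz hl0
    rw [card_sdiff_insert_eq_card_sub_six hG hd hk hB hnP hz]
    omega

/-- **h21's cell `(2, 1)` for every `|G| ≥ 44`**: at least two fat closures (gen 28), exactly one (gen 36), or none
(`localShadowHall_nonfat_of_large`). -/
theorem localShadowHall_two_one_of_large (hG : G ∈ flatsQ M (5 + 1)) (hd : (gr M \ G).card = 2)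
    (hk : kColoops M G = 1) (hs : ∀ e ∈ gr M, ∀ f ∈ gr M, e ≠ f → rkN M {e, f} = 2)
    (hl : ∀ e ∈ gr M, M.Indep {e}) (h44 : 44 ≤ G.card) : LocalShadowHall M 5 G := by
  rcases Nat.lt_or_ge (fatClosures M 5 G 2).card 2 with hlt | hge
  · rcases Nat.lt_or_ge (fatClosures M 5 G 2).card 1 with h0 | h1
    · have hnf : fatClosures M 5 G 2 = ∅ := Finset.card_eq_zero.1 (by omega)
      exact localShadowHall_nonfat_of_large hG hd hk hs hl hnf h44
    · obtain ⟨B₀, hB₀, hm₀⟩ := exists_fat_member_of_card_eq_one hG hd (by omega)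
      exact localShadowHall_fat hG hd hk hs hl (by omega) hB₀ hm₀
  · exact localShadowHall_two_one_five_fatClosures_free hG hd hk hs hl hge

end PercRepro.Shadow
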